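import Literature.Computability.Complexity.IrreducibilityLLLGcdFP
import Literature.Computability.Complexity.IrreducibilityLLLKernel
import Literature.Computability.Complexity.CodeFPFinite
import HarnessLib

/-!
# The null vector modulo `p` runs in polynomial time (`CodeFP`)

Support file for the discharge of the named fact
`Literature.Computability.Complexity.lll_monicIrreducible_mem_P` (irreducibility of monic integer
polynomials is decidable in `P`; Lenstra–Lenstra–Lovász 1982, §3). Machine side of
`IrreducibilityLLLKernel.lean` (Knuth §4.6.2, Algorithm N, the null space step of Berlekamp's
algorithm): the loop form `kerVecMod` of column elimination is computed on codes by a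
polynomial-time string function. The prime `p` is unary (`unE`) and every reduction is modulo
`p⁺ = max p 2` (identity on primes), as in `IrreducibilityLLLGcdFP.lean`:

* `elimRowsModC`, `kerFwdStepC`, `backSubC`;
* unconditional size invariants of the forward loop (`KRow`: every row and pivot is an input row or
  a reduced row not longer than the widest input row) and of the backward loop;
* **`kerVecModC`**: `(p, n, rows) ↦ kerVecMod p⁺ n rows` (`n` unary, output `optE (rawE intE)`).

## References

* S. Arora, B. Barak, *Computational Complexity: A Modern Approach*, CUP 2009, §1.3. [AroraBarak2009]
* D. E. Knuth, *The Art of Computer Programming*, Vol. 2, §4.6.2, Algorithm N. [KnuthTAOCP2]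
* A. K. Lenstra, H. W. Lenstra Jr., L. Lovász, Math. Ann. 261 (1982), §3 (3.1). [LenstraLenstraLovasz1982]
-/

noncomputable section

namespace Literature.Computability.Complexity

open Polynomial SumcheckMA CodeFP Brick _root_.Computability

namespace LLLFactoring

/-- The encoder of coefficient rows. -/
local notation "L" => rawE intE

/-! ### The primitives on codes -/

/-- The integer dot product on codes (`zipWith (*)`, then `sum`). [folklore] -/
theorem idotC : CodeFP (pairE L L) intE (fun t => idot t.1 t.2) := by
  have hz := zipWith (σ := Unit) (eσ := unitE) (eα := intE) (eβ := intE) (eγ := intE) (g := fun t => t.2.1 * t.2.2)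
    ((intMul.comp (snd _ _) :))
  exact ((intSum.comp (hz.comp ((const _ ()).pair (CodeFP.id _)))).congr fun _ => rfl)

/-- **Elimination modulo `p⁺`** on codes: `(p, piv, rows) ↦ elimRowsMod p⁺ piv rows`.
[cite: KnuthTAOCP2, §4.6.2, Algorithm N] -/
theorem elimRowsModC : CodeFP (pairE unE (pairE L (rawE L))) (rawE L) (fun t => elimRowsMod (max t.1 2) t.2.1 t.2.2) := by
  -- context of the row map: `σ = ((p⁺ : natE, inv), piv)`; of the entry zip: `(p⁺, h · inv)`
  have hg : CodeFP (pairE (pairE natE intE) (pairE intE intE)) intE (fun t => (t.2.1 - t.1.2 * t.2.2) % (t.1.1 : ℤ)) :=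
    (Literature.Algebra.EuclideanLattices.Khot.intEMod.comp ((intSub.comp ((snd _ _).fst'.pair (intMul.comp ((fst _ _).snd'.pair
      (snd _ _).snd')))).pair (intOfNat.comp (fst _ _).fst')) :)
  have hz := zipWith (σ := ℕ × ℤ) (eσ := pairE natE intE) (eα := intE) (eβ := intE) (eγ := intE)
    (g := fun t => (t.2.1 - t.1.2 * t.2.2) % (t.1.1 : ℤ)) hg
  -- the row map: item `r`, context `((P, inv), piv)`
  have hrow : CodeFP (pairE (pairE (pairE natE intE) L) L) L
      (fun t => (List.zipWith (fun a b => (a - (t.2.headD 0 * t.1.1.2) * b) % (t.1.1.1 : ℤ)) t.2 t.1.2).tail) :=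
    ((rawTail intE).comp (hz.comp ((((fst _ _).fst'.fst').pair (intMul.comp (((rawHeadOr intE).comp ((const _ (0 : ℤ)).pair
      (snd _ _))).pair (fst _ _).fst'.snd'))).pair ((snd _ _).pair (fst _ _).snd'))) :)
  have hm := map (σ := (ℕ × ℤ) × List ℤ) (eσ := pairE (pairE natE intE) L) (eα := L) (eβ := L)
    (g := fun t => (List.zipWith (fun a b => (a - (t.2.headD 0 * t.1.1.2) * b) % (t.1.1.1 : ℤ)) t.2 t.1.2).tail) hrow
  have hctx : CodeFP (pairE unE (pairE L (rawE L))) (pairE (pairE natE intE) L)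
      (fun t => ((max t.1 2, invMod (max t.1 2) (t.2.1.headD 0)), t.2.1)) :=
    (((maxTwoUnC.comp (fst _ _)).pair (invModC.comp ((fst _ _).pair ((rawHeadOr intE).comp ((const _ (0 : ℤ)).pair
      (snd _ _).fst'))))).pair (snd _ _).fst' :)
  exact ((hm.comp (hctx.pair (snd _ _).snd')).congr fun _ => rfl)

/-- The encoder of the forward state. -/
local notation "KF" => pairE (rawE (rawE intE)) (pairE (rawE (rawE intE)) bitE)

/-- **One forward step** on codes: `(p, st) ↦ kerFwdStep p⁺ st`. [cite: KnuthTAOCP2, §4.6.2, Algorithm N] -/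
theorem kerFwdStepC : CodeFP (pairE unE KF) KF (fun t => kerFwdStep (max t.1 2) t.2) := by
  have hp : CodeFP (pairE unE KF) unE (fun t => t.1) := (fst _ _ :)
  have hrows : CodeFP (pairE unE KF) (rawE L) (fun t => t.2.1) := ((snd _ _).fst' :)
  have hpiv : CodeFP (pairE unE KF) (rawE L) (fun t => t.2.2.1) := ((snd _ _).snd'.fst' :)
  have hfound : CodeFP (pairE unE KF) bitE (fun t => t.2.2.2) := ((snd _ _).snd'.snd' :)
  -- the pivot search: head nonzero modulo `p⁺`
  have hpred : CodeFP (pairE natE L) bitE (fun t => decide (t.2.headD 0 % (t.1 : ℤ) ≠ 0)) :=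
    ((intEq.comp ((Literature.Algebra.EuclideanLattices.Khot.intEMod.comp (((rawHeadOr intE).comp ((const _ (0 : ℤ)).pair
      (snd _ _))).pair (intOfNat.comp (fst _ _)))).pair (const _ (0 : ℤ)))).not.congr fun t => by simp)
  have hfind : CodeFP (pairE unE KF) (optE L) (fun t => t.2.1.find? fun r => decide (r.headD 0 % ((max t.1 2 : ℕ) : ℤ) ≠ 0)) :=
    ((rawFind? (σ := ℕ) (eσ := natE) (eα := L) hpred).comp ((maxTwoUnC.comp hp).pair hrows) :)
  -- the two outcomes
  have hnone : CodeFP (pairE unE KF) KF (fun t => (t.2.1, t.2.2.1, true)) := (hrows.pair (hpiv.pair (const _ true)) :)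
  have hsome : CodeFP (pairE (pairE unE KF) L) KF (fun t => (elimRowsMod (max t.1.1 2) t.2 t.1.2.1, t.2 :: t.1.2.2.1, false)) :=
    ((elimRowsModC.comp ((fst _ _).fst'.pair ((snd _ _).pair (fst _ _).snd'.fst'))).pair (((rawCons L).comp ((snd _ _).pair
      (fst _ _).snd'.snd'.fst')).pair (const _ false)) :)
  have hcases := optCases (σ := ℕ × KerFwd) (eσ := pairE unE KF) (eα := L) (eδ := KF)
    (k := fun s o => match o with | none => (s.2.1, s.2.2.1, true) | some piv => (elimRowsMod (max s.1 2) piv s.2.1, piv :: s.2.2.1, false))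
    hnone hsome (fun _ => rfl) (fun _ _ => rfl)
  have hact : CodeFP (pairE unE KF) KF (fun t => match t.2.1.find? fun r => decide (r.headD 0 % ((max t.1 2 : ℕ) : ℤ) ≠ 0) with
      | none => (t.2.1, t.2.2.1, true) | some piv => (elimRowsMod (max t.1 2) piv t.2.1, piv :: t.2.2.1, false)) :=
    ((hcases.comp ((CodeFP.id _).pair hfind)).congr fun _ => rfl)
  refine ((hfound.ite (snd _ _) hact).congr fun t => ?_)
  obtain ⟨p, rows, piv, found⟩ := t
  unfold kerFwdStep
  cases found <;> rfl

/-- **One back-substitution** on codes: `(p, piv, v) ↦ backSub p⁺ piv v`. [cite: KnuthTAOCP2, §4.6.2, Algorithm N] -/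
theorem backSubC : CodeFP (pairE unE (pairE L L)) L (fun t => backSub (max t.1 2) t.2.1 t.2.2) := by
  have hp : CodeFP (pairE unE (pairE L L)) unE (fun t => t.1) := (fst _ _ :)
  have hpiv : CodeFP (pairE unE (pairE L L)) L (fun t => t.2.1) := ((snd _ _).fst' :)
  have hv : CodeFP (pairE unE (pairE L L)) L (fun t => t.2.2) := ((snd _ _).snd' :)
  have hinv : CodeFP (pairE unE (pairE L L)) intE (fun t => invMod (max t.1 2) (t.2.1.headD 0)) :=
    (invModC.comp (hp.pair ((rawHeadOr intE).comp ((const _ (0 : ℤ)).pair hpiv))) :)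
  have hdot : CodeFP (pairE unE (pairE L L)) intE (fun t => idot t.2.1.tail t.2.2) := (idotC.comp (((rawTail intE).comp hpiv).pair hv) :)
  have hx : CodeFP (pairE unE (pairE L L)) intE (fun t => -(invMod (max t.1 2) (t.2.1.headD 0) * idot t.2.1.tail t.2.2) % ((max t.1 2 : ℕ) : ℤ)) :=
    (Literature.Algebra.EuclideanLattices.Khot.intEMod.comp ((intNeg.comp (intMul.comp (hinv.pair hdot))).pair
      (intOfNat.comp (maxTwoUnC.comp hp))) :)
  exact (((rawCons intE).comp (hx.pair hv)).congr fun _ => rfl)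

/-! ### Unconditional sizes along the forward loop -/

/-- The widest row. [folklore] -/
def maxLen (rows : List (List ℤ)) : ℕ := (rows.map List.length).foldr max 0

/-- Every row is at most as wide as the widest. [folklore] -/
theorem length_le_maxLen {rows : List (List ℤ)} {r : List ℤ} (h : r ∈ rows) : r.length ≤ maxLen rows := by
  induction rows with
  | nil => simp at h
  | cons a rows ih =>
    simp only [maxLen, List.map_cons, List.foldr_cons]
    rcases List.mem_cons.1 h with rfl | h
    · exact le_max_left _ _
    · exact (ih h).trans (le_max_right _ _)

/-- The widest row fits in the code. [folklore] -/
theorem maxLen_le_code (rows : List (List ℤ)) : maxLen rows ≤ (rawE (rawE intE) rows).length := by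
  induction rows with
  | nil => simp [maxLen]
  | cons a rows ih =>
    simp only [maxLen, List.map_cons, List.foldr_cons, rawE_cons, length_boolPair]
    refine max_le ?_ ?_
    · have := length_le_code a; omega
    · change maxLen rows ≤ _; omega

/-- A row of a forward state is an input row or a reduced row not wider than the input.
[folklore] -/
def KRow (p' : ℕ) (rows₀ : List (List ℤ)) (W : ℕ) (r : List ℤ) : Prop := r ∈ rows₀ ∨ (Reduced p' r ∧ r.length ≤ W)

/-- The size invariant of the forward loop after `j` steps. [folklore] -/
def KInv (p' : ℕ) (rows₀ : List (List ℤ)) (W j : ℕ) (st : KerFwd) : Prop :=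
  (∀ r ∈ st.1, KRow p' rows₀ W r) ∧ (∀ r ∈ st.2.1, KRow p' rows₀ W r) ∧ st.1.length ≤ rows₀.length ∧ st.2.1.length ≤ j ∧
    ∀ r ∈ st.1, r.length ≤ W

/-- **One forward step keeps the invariant** (`p' ≥ 1`). [folklore] -/
theorem kinv_step {p' : ℕ} (hp : 0 < p') {rows₀ : List (List ℤ)} {W j : ℕ} {st : KerFwd} (h : KInv p' rows₀ W j st) :
    KInv p' rows₀ W (j + 1) (kerFwdStep p' st) := by
  obtain ⟨rows, piv, found⟩ := st
  obtain ⟨h1, h2, h3, h4, h5⟩ := h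
  dsimp only at h1 h2 h3 h4 h5
  unfold kerFwdStep
  cases found
  · simp only [Bool.false_eq_true, ↓reduceIte]
    cases hf : rows.find? (fun r => decide (r.headD 0 % (p' : ℤ) ≠ 0)) with
    | none => exact ⟨h1, h2, h3, h4.trans (Nat.le_succ _), h5⟩
    | some pv =>
      have hpv : pv ∈ rows := List.mem_of_find?_eq_some hf
      have hpvW : pv.length ≤ W := h5 pv hpv
      refine ⟨fun r hr => Or.inr ⟨reducedRows_elimRowsMod hp pv rows r hr, ((length_elimRowsMod pv rows).2 r hr).trans hpvW⟩,
        fun r hr => ?_, by rw [(length_elimRowsMod pv rows).1]; exact h3, by rw [List.length_cons]; omega,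
        fun r hr => ((length_elimRowsMod pv rows).2 r hr).trans hpvW⟩
      rcases List.mem_cons.1 hr with rfl | hr
      · exact h1 _ hpv
      · exact h2 r hr
  · simp only [↓reduceIte]
    exact ⟨h1, h2, h3, h4.trans (Nat.le_succ _), h5⟩

/-- The run from `(rows₀, [], false)`. [folklore] -/
theorem kinv_run {p' : ℕ} (hp : 0 < p') (rows₀ : List (List ℤ)) (u : List Unit) :
    KInv p' rows₀ (maxLen rows₀) u.length (u.foldl (fun st _ => kerFwdStep p' st) (rows₀, [], false)) := by
  induction u using List.reverseRecOn with
  | nil =>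
    exact ⟨fun r hr => Or.inl hr, fun r hr => by simp at hr, le_rfl, le_rfl, fun r hr => length_le_maxLen hr⟩
  | append_singleton u x ih =>
    rw [List.foldl_append, List.foldl_cons, List.foldl_nil, List.length_append, List.length_singleton]
    exact kinv_step hp ih

/-- The code of a list of rows each coding in `≤ E` symbols. [folklore] -/
theorem length_rawE_rawE_le {rows : List (List ℤ)} {E : ℕ} (h : ∀ r ∈ rows, (rawE intE r).length ≤ E) :
    (rawE (rawE intE) rows).length ≤ rows.length * (2 * E + 2) := by
  rw [length_rawE]
  have : ∀ x ∈ rows.map (fun r => 2 * (rawE intE r).length + 2), x ≤ 2 * E + 2 := fun x hx => by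
    obtain ⟨r, hr, rfl⟩ := List.mem_map.1 hx
    have := h r hr; omega
  simpa using List.sum_le_card_nsmul _ _ this

/-- The code of a row of a forward state: an input row fits in the input code, a reduced narrow row
in `Lc (12 Lc + 18)`. [folklore] -/
theorem length_code_krow_le {p Lc : ℕ} {rows₀ : List (List ℤ)} {r : List ℤ} (h : KRow (max p 2) rows₀ (maxLen rows₀) r)
    (hrows : (rawE (rawE intE) rows₀).length ≤ Lc) (hp : p ≤ Lc) : (rawE intE r).length ≤ Lc * (12 * Lc + 18) + Lc := by
  rcases h with h | ⟨hred, hlen⟩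
  · have := length_item_le_length_rawE (rawE intE) h; omega
  · have hW : maxLen rows₀ ≤ Lc := (maxLen_le_code rows₀).trans hrows
    have hsz : Nat.size p ≤ Lc := (Nat.size_le.2 (Nat.lt_two_pow_self)).trans hp
    have := length_code_le_of_reduced_max hred (hlen.trans hW) hsz
    omega

/-! ### The null vector on codes -/

/-- **`kerVecMod p⁺ n rows`** on codes (`p`, `n` unary): the forward fold over `n` ticks (state of
`kinv_run`), then — if a free column was met — the backward fold over the recorded pivots from the
unit vector, all entries reduced modulo `p⁺`. [cite: KnuthTAOCP2, §4.6.2, Algorithm N] [cite: AroraBarak2009, §1.3] -/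
theorem kerVecModC : CodeFP (pairE unE (pairE unE (rawE L))) (optE L) (fun t => kerVecMod (max t.1 2) t.2.1 t.2.2) := by
  -- forward
  have hstep : CodeFP (pairE (pairE unE (pairE unE (rawE L))) (pairE unitE KF)) KF (fun t => kerFwdStep (max t.1.1 2) t.2.2) :=
    (kerFwdStepC.comp ((fst _ _).fst'.pair (snd _ _).snd') :)
  have hinit : CodeFP (pairE unE (pairE unE (rawE L))) KF (fun s => (s.2.2, ([] : List (List ℤ)), false)) :=
    ((snd _ _).snd'.pair ((const _ ([] : List (List ℤ))).pair (const _ false)) :)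
  have hfwd := foldl (σ := ℕ × (ℕ × List (List ℤ))) (α := Unit) (β := KerFwd) (eσ := pairE unE (pairE unE (rawE L))) (eα := unitE)
    (eβ := KF) (step := fun s _ st => kerFwdStep (max s.1 2) st) (init := fun s => (s.2.2, [], false)) hstep hinit
    (200 * (X + 1) ^ 3) (fun s l₁ l₂ => by
      obtain ⟨p, n, rows⟩ := s
      change (pairE (rawE (rawE intE)) (pairE (rawE (rawE intE)) bitE) (l₁.foldl (fun st (_ : Unit) => kerFwdStep (max p 2) st) (rows, [], false))).length ≤ _
      set Lc := (pairE (pairE unE (pairE unE (rawE L))) (rawE unitE) ((p, n, rows), l₁ ++ l₂)).length with hLc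
      have hP : 0 < max p 2 := lt_of_lt_of_le (by norm_num) (le_max_right _ _)
      obtain ⟨h1, h2, h3, h4, -⟩ := kinv_run hP rows l₁
      set st := l₁.foldl (fun st (_ : Unit) => kerFwdStep (max p 2) st) (rows, [], false)
      have hLr : (rawE (rawE intE) rows).length ≤ Lc := by rw [hLc]; simp only [pairE_apply, length_boolPair]; omega
      have hLp : p ≤ Lc := by rw [hLc]; simp only [pairE_apply, length_boolPair, length_unE]; omega
      have hLu : l₁.length ≤ Lc := by
        rw [hLc]; simp only [pairE_apply, length_boolPair]
        have := length_le_length_rawE unitE (l₁ ++ l₂); rw [List.length_append] at this; omega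
      have hLn : rows.length ≤ Lc := (length_le_length_rawE (rawE intE) rows).trans hLr
      have e1 := length_rawE_rawE_le fun r hr => length_code_krow_le (h1 r hr) hLr hLp
      have e2 := length_rawE_rawE_le fun r hr => length_code_krow_le (h2 r hr) hLr hLp
      have f1 : st.1.length * (2 * (Lc * (12 * Lc + 18) + Lc) + 2) ≤ Lc * (2 * (Lc * (12 * Lc + 18) + Lc) + 2) :=
        Nat.mul_le_mul_right _ (h3.trans hLn)
      have f2 : st.2.1.length * (2 * (Lc * (12 * Lc + 18) + Lc) + 2) ≤ Lc * (2 * (Lc * (12 * Lc + 18) + Lc) + 2) :=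
        Nat.mul_le_mul_right _ (h4.trans hLu)
      have hb : (bitE st.2.2).length = 1 := rfl
      simp only [pairE_apply, length_boolPair, eval_mul, eval_pow, eval_add, eval_X, eval_ofNat, eval_one, hb]
      nlinarith)
  have hst : CodeFP (pairE unE (pairE unE (rawE L))) KF (fun t => kerFwdRun (max t.1 2) t.2.1 (t.2.2, [], false)) :=
    ((hfwd.comp ((CodeFP.id _).pair (replicateUnit.comp (snd _ _).fst'))).congr fun _ => rfl)
  -- backward: fold over the pivots with context `σ = (p, (n, pivots))`
  have hbstep : CodeFP (pairE (pairE unE (pairE unE (rawE L))) (pairE L L)) L (fun t => backSub (max t.1.1 2) t.2.1 t.2.2) :=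
    (backSubC.comp ((fst _ _).fst'.pair (snd _ _)) :)
  have hv0 : CodeFP (pairE unE (pairE unE (rawE L))) L (fun s => (1 : ℤ) :: List.replicate (s.2.1 - s.2.2.length - 1) 0) :=
    ((rawCons intE).comp ((const _ (1 : ℤ)).pair ((replicateOf intE).comp ((const _ (0 : ℤ)).pair ((unSubLen unitE).comp
      (((unSubLen L).comp ((snd _ _).fst'.pair (snd _ _).snd')).pair (const _ [()])))))) :)
  have hbwd := foldl (σ := ℕ × (ℕ × List (List ℤ))) (α := List ℤ) (β := List ℤ) (eσ := pairE unE (pairE unE (rawE L))) (eα := L)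
    (eβ := L) (step := fun s piv v => backSub (max s.1 2) piv v) (init := fun s => (1 : ℤ) :: List.replicate (s.2.1 - s.2.2.length - 1) 0)
    hbstep hv0 (90 * (X + 1) ^ 2) (fun s l₁ l₂ => by
      obtain ⟨p, n, pivs⟩ := s
      change (rawE intE (l₁.foldl (fun v piv => backSub (max p 2) piv v) ((1 : ℤ) :: List.replicate (n - pivs.length - 1) 0))).length ≤ _
      set Lc := (pairE (pairE unE (pairE unE (rawE L))) (rawE L) ((p, n, pivs), l₁ ++ l₂)).length with hLc
      have hP : 0 < max p 2 := lt_of_lt_of_le (by norm_num) (le_max_right _ _)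
      have hinv : ∀ u : List (List ℤ), Reduced (max p 2) (u.foldl (fun v piv => backSub (max p 2) piv v) ((1 : ℤ) :: List.replicate (n - pivs.length - 1) 0)) ∧
          (u.foldl (fun v piv => backSub (max p 2) piv v) ((1 : ℤ) :: List.replicate (n - pivs.length - 1) 0)).length = n - pivs.length - 1 + 1 + u.length := by
        intro u
        induction u using List.reverseRecOn with
        | nil =>
          refine ⟨fun x hx => ?_, by simp⟩
          rcases List.mem_cons.1 hx with rfl | hx
          · exact ⟨zero_le_one, by have := le_max_right p 2; omega⟩
          · rw [List.eq_of_mem_replicate hx]; exact ⟨le_rfl, by exact_mod_cast hP⟩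
        | append_singleton u x ih =>
          rw [List.foldl_append, List.foldl_cons, List.foldl_nil, List.length_append, List.length_singleton]
          exact ⟨reduced_backSub hP x ih.1, by rw [backSub, List.length_cons, ih.2]; omega⟩
      obtain ⟨hred, hlen⟩ := hinv l₁
      have hLp : p ≤ Lc := by rw [hLc]; simp only [pairE_apply, length_boolPair, length_unE]; omega
      have hLn : n ≤ Lc := by rw [hLc]; simp only [pairE_apply, length_boolPair, length_unE]; omega
      have hLu : l₁.length ≤ Lc := by
        rw [hLc]; simp only [pairE_apply, length_boolPair]
        have := length_le_length_rawE L (l₁ ++ l₂); rw [List.length_append] at this; omega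
      have hsz : Nat.size p ≤ 2 * Lc + 1 := (Nat.size_le.2 (Nat.lt_two_pow_self)).trans (by omega)
      have := length_code_le_of_reduced_max (Lc := 2 * Lc + 1) hred (by omega) hsz
      simp only [eval_mul, eval_pow, eval_add, eval_X, eval_ofNat, eval_one]
      nlinarith)
  have hsome : CodeFP (pairE unE (pairE unE (rawE L))) L (fun t =>
      (kerFwdRun (max t.1 2) t.2.1 (t.2.2, [], false)).2.1.foldl (fun v piv => backSub (max t.1 2) piv v)
        ((1 : ℤ) :: List.replicate (t.2.1 - (kerFwdRun (max t.1 2) t.2.1 (t.2.2, [], false)).2.1.length - 1) 0)) :=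
    ((hbwd.comp ((((fst _ _).pair ((snd _ _).fst'.pair hst.snd'.fst')).pair hst.snd'.fst'))).congr fun _ => rfl)
  refine ((hst.snd'.snd'.ite ((optSome L).comp hsome) (const _ (none : Option (List ℤ)))).congr fun t => ?_)
  show (if (kerFwdRun (max t.1 2) t.2.1 (t.2.2, [], false)).2.2 then _ else _) = kerVecMod (max t.1 2) t.2.1 t.2.2
  unfold kerVecMod
  rfl

end LLLFactoring

end Literature.Computability.Complexity
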